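import Literature.Probability.Percolation.SelfRefinementMeasure
import Literature.Probability.Percolation.KohlerSchindlerTassionRSW
import Summits.CriticalPhenomena.CardyFormulaZ2.Theorems.CardySelfRefinementCriticalPathRSWStubPhaseDiagramLandmarksA
import Summits.CriticalPhenomena.CardyFormulaZ2.Theorems.CardySelfRefinementCriticalPathRSWStubCone3Russo
import Summits.CriticalPhenomena.CardyFormulaZ2.Theorems.CardySelfRefinementCriticalPathRSWStubCone3Model

/-!
# Stub `stub_cone3` of line `finite-size-envelope` (crux `CriticalPathRSW`), part 4:
the override events `Z⟪C, A⟫` and the sections of the crossing event at the coins of a tuple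

Support file for item `stmt-CriticalPhenomena-10267` (stub `stub_cone3`).  Write `Op⟪S⟫` for the
set of open labels of the coin configuration `S` (`refinementConfig 3 S = edgeConfig Op⟪S⟫`), and
for finite sets `C`, `A` of labels let `Z⟪C, A⟫` be the event that the configuration obtained from
`Op⟪S⟫` by CLOSING the labels of `C` and then OPENING those of `A` has a left-right open crossing
of the box `[-3n, 3n] × [-9n, 9n]` (`KST2023.crossing (3n) (9n)`).  All notations are local
(set-builder expressions), so the file declares nothing but theorems.  Proved here, for the tuple
`(b, d)` in its local frame `pt⟪α, β⟫ = 3b + α e_d + β e_{d'}`: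

* `Z⟪C, A⟫` is measurable and monotone (`A ↑`, `C ↓`), `Z⟪C, A⟫ = Z⟪C ∪ A, A⟫`, and on an event
  where the labels of `C'` are closed `Z⟪C, A⟫ = Z⟪C ∪ C', A⟫`;
* **locality** (`Cone3.determinedBy_Z`): if `C ∪ A` contains the three sub-edges of the tuple and a
  set `Λ` of labels, then `Z⟪C, A⟫` is determined by the coins other than the five coins of the
  tuple and the own coins of `Λ` (so it is independent of every cylinder over those coins);
* **sections**: removing / inserting the selector `(b, d, 2)` turns `Op⟪S⟫` into
  `(Op⟪S⟫ \ T) ∪ {sub-edges whose own coin is on}` resp. `(Op⟪S⟫ \ T) ∪ (T if the shared coin is on)`;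
  inserting / removing the own coin of a non-axial label `g` opens / closes exactly `g`;
* the pulled-back crossing event is `Z⟪∅, ∅⟫`, and `P(X) - P(Y) = P(X \ Y) - P(Y \ X)`.

References: Grimmett 1999 §2.2, §2.4; Aizenman–Grimmett 1991 §2.
-/

noncomputable section

namespace Summit.CriticalPhenomena.CardyFormulaZ2.Cruxes.CriticalPathRSW.FiniteSizeEnvelope

open Set MeasureTheory
open Literature.Probability.LatticeModels Literature.Probability.Percolation

namespace Cone3

variable {n : ℕ} {b : Site 2} {d d' : Fin 2}

set_option quotPrecheck false

/-- The local frame of the tuple `(b, d)`: `pt⟪α, β⟫ = 3b + α e_d + β e_{d'}`. -/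
local notation "pt⟪" α ", " β "⟫" =>
  ((3 : ℤ) • b + (α : ℤ) • (Pi.single d (1 : ℤ) : Site 2) + (β : ℤ) • (Pi.single d' (1 : ℤ) : Site 2))

/-- The open labels of a coin configuration. -/
local notation "Op⟪" S "⟫" => {e : Site 2 × Fin 2 | RefinementOpen 3 S e}

/-- The override event: close `C`, open `A`, and ask for a left-right crossing of the box. -/
local notation "Z⟪" C ", " A "⟫" =>
  {S : Set (Site 2 × Fin 2 × Fin 3) |
    edgeConfig ((Op⟪S⟫ \ C) ∪ A) ∈ KST2023.crossing (3 * n) (3 * (3 * n))}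

/-- The three sub-edges of the tuple. -/
local notation "Tl" =>
  ({(pt⟪0, 0⟫, d), (pt⟪1, 0⟫, d), (pt⟪2, 0⟫, d)} : Set (Site 2 × Fin 2))

/-- The sub-edges whose own coin lies in `X`. -/
local notation "Tof⟪" X "⟫" =>
  {e : Site 2 × Fin 2 | (e = (pt⟪0, 0⟫, d) ∧ (pt⟪0, 0⟫, d, (0 : Fin 3)) ∈ X) ∨
    (e = (pt⟪1, 0⟫, d) ∧ (pt⟪1, 0⟫, d, (0 : Fin 3)) ∈ X) ∨ (e = (pt⟪2, 0⟫, d) ∧ (pt⟪2, 0⟫, d, (0 : Fin 3)) ∈ X)}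

/-- All sub-edges if the shared coin lies in `X`, nothing otherwise. -/
local notation "Th⟪" X "⟫" =>
  {e : Site 2 × Fin 2 | (e = (pt⟪0, 0⟫, d) ∨ e = (pt⟪1, 0⟫, d) ∨ e = (pt⟪2, 0⟫, d)) ∧ (b, d, (1 : Fin 3)) ∈ X}

/-! ### Generalities on the override events -/

/-- A larger set of open labels still crosses. -/
theorem crossing_mono {V V' : Set (Site 2 × Fin 2)} (h : V ⊆ V') {m k : ℕ}
    (hV : edgeConfig V ∈ KST2023.crossing m k) : edgeConfig V' ∈ KST2023.crossing m k :=
  KST2023.isUpperSet_crossing m k (Set.image_mono h) hV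

/-- `Z⟪C, A⟫` is monotone in the opened set. -/
theorem Z_mono_open (C : Set (Site 2 × Fin 2)) {A A' : Set (Site 2 × Fin 2)} (h : A ⊆ A') :
    Z⟪C, A⟫ ⊆ Z⟪C, A'⟫ :=
  fun _ hS => crossing_mono (Set.union_subset_union_right _ h) hS

/-- `Z⟪C, A⟫` is antitone in the closed set. -/
theorem Z_anti_closed {C C' : Set (Site 2 × Fin 2)} (h : C ⊆ C') (A : Set (Site 2 × Fin 2)) :
    Z⟪C', A⟫ ⊆ Z⟪C, A⟫ :=
  fun _ hS => crossing_mono (Set.union_subset_union_left _ (Set.sdiff_subset_sdiff_right h)) hS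

/-- Closing what is reopened changes nothing: `Z⟪C, A⟫ = Z⟪C ∪ A, A⟫`. -/
theorem Z_eq_Z_union (C A : Set (Site 2 × Fin 2)) : Z⟪C, A⟫ = Z⟪C ∪ A, A⟫ := by
  ext S
  simp only [Set.mem_setOf_eq]
  have h : (Op⟪S⟫ \ C) ∪ A = (Op⟪S⟫ \ (C ∪ A)) ∪ A := by
    ext e
    simp only [Set.mem_union, Set.mem_sdiff, Set.mem_setOf_eq]
    tauto
  rw [h]

/-- On an event where the labels of `C'` are all closed, closing them changes nothing. -/
theorem Z_inter_eq_of_closed {C C' A : Set (Site 2 × Fin 2)} {Y : Set (Set (Site 2 × Fin 2 × Fin 3))}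
    (hY : ∀ S ∈ Y, ∀ e ∈ C', ¬ RefinementOpen 3 S e) : Z⟪C, A⟫ ∩ Y = Z⟪C ∪ C', A⟫ ∩ Y := by
  ext S
  simp only [Set.mem_inter_iff, Set.mem_setOf_eq]
  constructor
  · rintro ⟨h, hSY⟩
    refine ⟨?_, hSY⟩
    have heq : (Op⟪S⟫ \ C) ∪ A = (Op⟪S⟫ \ (C ∪ C')) ∪ A := by
      ext e
      simp only [Set.mem_union, Set.mem_sdiff, Set.mem_setOf_eq]
      constructor
      · rintro (⟨h1, h2⟩ | h3)
        · exact Or.inl ⟨h1, fun h' => h'.elim h2 (fun h'' => hY S hSY e h'' h1)⟩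
        · exact Or.inr h3
      · rintro (⟨h1, h2⟩ | h3)
        · exact Or.inl ⟨h1, fun h' => h2 (Or.inl h')⟩
        · exact Or.inr h3
    rwa [heq] at h
  · rintro ⟨h, hSY⟩
    exact ⟨Z_anti_closed Set.subset_union_left A h, hSY⟩

/-- On an event where the labels of `A'` are all open and not closed, opening them changes nothing. -/
theorem Z_inter_eq_of_open {C A A' : Set (Site 2 × Fin 2)} {Y : Set (Set (Site 2 × Fin 2 × Fin 3))}
    (hY : ∀ S ∈ Y, ∀ e ∈ A', RefinementOpen 3 S e) (hAC : ∀ e ∈ A', e ∉ C) :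
    Z⟪C, A⟫ ∩ Y = Z⟪C, A ∪ A'⟫ ∩ Y := by
  ext S
  simp only [Set.mem_inter_iff, Set.mem_setOf_eq]
  constructor
  · rintro ⟨h, hSY⟩
    exact ⟨Z_mono_open C Set.subset_union_left h, hSY⟩
  · rintro ⟨h, hSY⟩
    refine ⟨?_, hSY⟩
    have heq : (Op⟪S⟫ \ C) ∪ (A ∪ A') = (Op⟪S⟫ \ C) ∪ A := by
      ext e
      simp only [Set.mem_union, Set.mem_sdiff, Set.mem_setOf_eq]
      constructor
      · rintro (h1 | h2 | h3)
        · exact Or.inl h1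
        · exact Or.inr h2
        · exact Or.inl ⟨hY S hSY e h3, hAC e h3⟩
      · tauto
    rwa [heq] at h

/-- The map "close `C`, open `A`" from coins to open labels is measurable. -/
theorem measurable_op_override (C A : Set (Site 2 × Fin 2)) :
    Measurable fun S : Set (Site 2 × Fin 2 × Fin 3) => (Op⟪S⟫ \ C) ∪ A := by
  refine measurable_set_iff.2 fun e => ?_
  have h : (fun S : Set (Site 2 × Fin 2 × Fin 3) => e ∈ (Op⟪S⟫ \ C) ∪ A) =
      fun S => (RefinementOpen 3 S e ∧ e ∉ C) ∨ e ∈ A := by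
    funext S
    simp only [Set.mem_union, Set.mem_sdiff, Set.mem_setOf_eq]
  rw [h]
  exact ((measurable_refinementOpen 3 e).and measurable_const).or measurable_const

/-- **`Z⟪C, A⟫` is measurable.** -/
theorem measurableSet_Z (C A : Set (Site 2 × Fin 2)) : MeasurableSet Z⟪C, A⟫ :=
  (measurable_edgeConfig.comp (measurable_op_override C A))
    (measurableSet_openCrossing_of_countable _ _ _)

/-- More generally the override preimage of any measurable set of configurations is measurable. -/
theorem measurableSet_override (C A : Set (Site 2 × Fin 2)) {𝒜 : Set (BondConfig (Site 2))}
    (h𝒜 : MeasurableSet 𝒜) :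
    MeasurableSet {S : Set (Site 2 × Fin 2 × Fin 3) | edgeConfig ((Op⟪S⟫ \ C) ∪ A) ∈ 𝒜} :=
  (measurable_edgeConfig.comp (measurable_op_override C A)) h𝒜

/-- The pulled-back crossing event is `Z⟪∅, ∅⟫`. -/
theorem preimage_crossing_eq_Z :
    (refinementConfig 3) ⁻¹' KST2023.crossing (3 * n) (3 * (3 * n)) =
      Z⟪(∅ : Set (Site 2 × Fin 2)), (∅ : Set (Site 2 × Fin 2))⟫ := by
  ext S
  simp only [Set.mem_preimage, Set.mem_setOf_eq, Set.sdiff_empty, Set.union_empty,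
    refinementConfig_eq_edgeConfig]

/-- `P(X) - P(Y) = P(X \ Y) - P(Y \ X)` for measurable events of a finite measure. -/
theorem measureReal_sub_eq_sdiff_sub_sdiff {α : Type*} [MeasurableSpace α] (μ : Measure α) [IsFiniteMeasure μ]
    {X Y : Set α} (hX : MeasurableSet X) (hY : MeasurableSet Y) :
    μ.real X - μ.real Y = μ.real (X \ Y) - μ.real (Y \ X) := by
  have h1 := measureReal_inter_add_sdiff (μ := μ) (s := X) hY
  have h2 := measureReal_inter_add_sdiff (μ := μ) (s := Y) hX
  rw [Set.inter_comm Y X] at h2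
  linarith

/-! ### Locality of the override events -/

/-- **Locality, general form.** Let `K₀` be a finite set of coins contained in the five coins of the
tuple and the own coins of the labels of `Λ`, and suppose `C ∪ A` contains the three sub-edges and
`Λ`.  Then the override preimage of ANY set of configurations is determined by the coins outside
`K₀` (the overridden label set is literally the same). -/
theorem determinedBy_override (hd : d' ≠ d) {K₀ : Finset (Site 2 × Fin 2 × Fin 3)} {Λ C A : Set (Site 2 × Fin 2)}
    (hK : (↑K₀ : Set (Site 2 × Fin 2 × Fin 3)) ⊆ {(b, d, (2 : Fin 3)), (b, d, (1 : Fin 3)),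
      (pt⟪0, 0⟫, d, (0 : Fin 3)), (pt⟪1, 0⟫, d, (0 : Fin 3)), (pt⟪2, 0⟫, d, (0 : Fin 3))} ∪
        (fun ℓ : Site 2 × Fin 2 => (ℓ.1, ℓ.2, (0 : Fin 3))) '' Λ)
    (hC : ∀ e : Site 2 × Fin 2, (e = (pt⟪0, 0⟫, d) ∨ e = (pt⟪1, 0⟫, d) ∨ e = (pt⟪2, 0⟫, d) ∨ e ∈ Λ) →
      e ∈ C ∪ A) (𝒜 : Set (BondConfig (Site 2))) :
    DeterminedBy {S : Set (Site 2 × Fin 2 × Fin 3) | edgeConfig ((Op⟪S⟫ \ C) ∪ A) ∈ 𝒜}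
      (↑K₀ : Set (Site 2 × Fin 2 × Fin 3))ᶜ := by
  rw [determinedBy_iff]
  intro S S' hSS'
  have hS : ∀ i, i ∉ (↑K₀ : Set (Site 2 × Fin 2 × Fin 3)) → (i ∈ S ↔ i ∈ S') := fun i hi =>
    ⟨fun h => ((Set.ext_iff.1 hSS' i).1 ⟨h, hi⟩).1, fun h => ((Set.ext_iff.1 hSS' i).2 ⟨h, hi⟩).1⟩
  simp only [Set.mem_setOf_eq]
  suffices heq : (Op⟪S⟫ \ C) ∪ A = (Op⟪S'⟫ \ C) ∪ A by rw [heq]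
  ext e
  simp only [Set.mem_union, Set.mem_sdiff, Set.mem_setOf_eq]
  by_cases heA : e ∈ A
  · simp [heA]
  by_cases heC : e ∈ C
  · simp [heC, heA]
  have hne : ¬ (e = (pt⟪0, 0⟫, d) ∨ e = (pt⟪1, 0⟫, d) ∨ e = (pt⟪2, 0⟫, d) ∨ e ∈ Λ) := fun h =>
    (hC e h).elim heC heA
  push Not at hne
  rw [refinementOpen_congr_off hd hK hS hne.1 hne.2.1 hne.2.2.1 hne.2.2.2]

/-- **Locality.** `Z⟪C, A⟫` is determined by the coins outside `K₀` under the same hypotheses. -/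
theorem determinedBy_Z (hd : d' ≠ d) {K₀ : Finset (Site 2 × Fin 2 × Fin 3)} {Λ C A : Set (Site 2 × Fin 2)}
    (hK : (↑K₀ : Set (Site 2 × Fin 2 × Fin 3)) ⊆ {(b, d, (2 : Fin 3)), (b, d, (1 : Fin 3)),
      (pt⟪0, 0⟫, d, (0 : Fin 3)), (pt⟪1, 0⟫, d, (0 : Fin 3)), (pt⟪2, 0⟫, d, (0 : Fin 3))} ∪
        (fun ℓ : Site 2 × Fin 2 => (ℓ.1, ℓ.2, (0 : Fin 3))) '' Λ)
    (hC : ∀ e : Site 2 × Fin 2, (e = (pt⟪0, 0⟫, d) ∨ e = (pt⟪1, 0⟫, d) ∨ e = (pt⟪2, 0⟫, d) ∨ e ∈ Λ) →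
      e ∈ C ∪ A) :
    DeterminedBy Z⟪C, A⟫ (↑K₀ : Set (Site 2 × Fin 2 × Fin 3))ᶜ :=
  determinedBy_override hd hK hC _

/-! ### Sections at the selector and at an own coin -/

/-- Removing the selector: every sub-edge follows its own coin, nothing else changes. -/
theorem op_diff_selector (hd : d' ≠ d) (S : Set (Site 2 × Fin 2 × Fin 3)) :
    Op⟪S \ {(b, d, (2 : Fin 3))}⟫ = (Op⟪S⟫ \ Tl) ∪ Tof⟪S⟫ := by
  ext e
  simp only [Set.mem_setOf_eq, Set.mem_union, Set.mem_sdiff, Set.mem_insert_iff, Set.mem_singleton_iff]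
  by_cases he : e = (pt⟪0, 0⟫, d) ∨ e = (pt⟪1, 0⟫, d) ∨ e = (pt⟪2, 0⟫, d)
  · have key : ∀ j : ℤ, 0 ≤ j → j < 3 → (RefinementOpen 3 (S \ {(b, d, (2 : Fin 3))}) (pt⟪j, 0⟫, d) ↔
        (pt⟪j, 0⟫, d, (0 : Fin 3)) ∈ S) := by
      intro j h0 h3
      rw [refinementOpen_sub_iff hd _ h0 h3]
      simp
    rcases he with rfl | rfl | rfl
    · rw [key 0 le_rfl (by norm_num)]
      simp only [true_or, not_true_eq_false, and_false, false_or, true_and]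
      constructor
      · intro h; exact Or.inl h
      · rintro (h | ⟨h, -⟩ | ⟨h, -⟩)
        · exact h
        · exact absurd (pt_inj hd (Prod.ext_iff.1 h).1).1 (by norm_num)
        · exact absurd (pt_inj hd (Prod.ext_iff.1 h).1).1 (by norm_num)
    · rw [key 1 (by norm_num) (by norm_num)]
      simp only [true_or, or_true, not_true_eq_false, and_false, false_or, true_and]
      constructor
      · intro h; exact Or.inr (Or.inl h)
      · rintro (⟨h, -⟩ | h | ⟨h, -⟩)
        · exact absurd (pt_inj hd (Prod.ext_iff.1 h).1).1 (by norm_num)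
        · exact h
        · exact absurd (pt_inj hd (Prod.ext_iff.1 h).1).1 (by norm_num)
    · rw [key 2 (by norm_num) (by norm_num)]
      simp only [or_true, not_true_eq_false, and_false, false_or, true_and]
      constructor
      · intro h; exact Or.inr (Or.inr h)
      · rintro (⟨h, -⟩ | ⟨h, -⟩ | h)
        · exact absurd (pt_inj hd (Prod.ext_iff.1 h).1).1 (by norm_num)
        · exact absurd (pt_inj hd (Prod.ext_iff.1 h).1).1 (by norm_num)
        · exact h
  · push Not at he
    have hcongr : RefinementOpen 3 (S \ {(b, d, (2 : Fin 3))}) e ↔ RefinementOpen 3 S e := by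
      refine refinementOpen_congr_off hd (K₀ := {(b, d, (2 : Fin 3))}) (Λ := ∅) (S' := S) ?_ ?_
        he.1 he.2.1 he.2.2 (Set.notMem_empty e)
      · intro i hi
        rw [Set.mem_singleton_iff] at hi
        subst hi
        exact Or.inl (by simp)
      · intro i hi
        simp only [Set.mem_singleton_iff] at hi
        simp [hi]
    rw [hcongr]
    simp only [he.1, he.2.1, he.2.2, false_and, or_self, or_false, not_false_eq_true, and_true]

/-- Inserting the selector: every sub-edge follows the shared coin, nothing else changes. -/
theorem op_insert_selector (hd : d' ≠ d) (S : Set (Site 2 × Fin 2 × Fin 3)) :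
    Op⟪insert (b, d, (2 : Fin 3)) S⟫ = (Op⟪S⟫ \ Tl) ∪ Th⟪S⟫ := by
  ext e
  simp only [Set.mem_setOf_eq, Set.mem_union, Set.mem_sdiff, Set.mem_insert_iff, Set.mem_singleton_iff]
  by_cases he : e = (pt⟪0, 0⟫, d) ∨ e = (pt⟪1, 0⟫, d) ∨ e = (pt⟪2, 0⟫, d)
  · have key : ∀ j : ℤ, 0 ≤ j → j < 3 → (RefinementOpen 3 (insert (b, d, (2 : Fin 3)) S) (pt⟪j, 0⟫, d) ↔
        (b, d, (1 : Fin 3)) ∈ S) := by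
      intro j h0 h3
      rw [refinementOpen_sub_iff hd _ h0 h3]
      simp
    have h' : RefinementOpen 3 (insert (b, d, (2 : Fin 3)) S) e ↔ (b, d, (1 : Fin 3)) ∈ S := by
      rcases he with rfl | rfl | rfl
      · exact key 0 le_rfl (by norm_num)
      · exact key 1 (by norm_num) (by norm_num)
      · exact key 2 (by norm_num) (by norm_num)
    rw [h']
    simp only [he, not_true_eq_false, and_false, false_or, true_and]
  · push Not at he
    have hcongr : RefinementOpen 3 (insert (b, d, (2 : Fin 3)) S) e ↔ RefinementOpen 3 S e := by
      refine refinementOpen_congr_off hd (K₀ := {(b, d, (2 : Fin 3))}) (Λ := ∅) (S' := S) ?_ ?_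
        he.1 he.2.1 he.2.2 (Set.notMem_empty e)
      · intro i hi
        rw [Set.mem_singleton_iff] at hi
        subst hi
        exact Or.inl (by simp)
      · intro i hi
        simp only [Set.mem_singleton_iff] at hi
        simp [hi]
    rw [hcongr]
    simp only [he.1, he.2.1, he.2.2, false_and, or_false, not_false_eq_true, and_true]

/-- Inserting the own coin of a non-axial label opens exactly that label. -/
theorem op_insert_own {g : Site 2 × Fin 2} (hg : ¬ IsAxialEdge 3 g) (S : Set (Site 2 × Fin 2 × Fin 3)) :
    Op⟪insert (g.1, g.2, (0 : Fin 3)) S⟫ = Op⟪S⟫ ∪ {g} := by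
  ext e
  simp only [Set.mem_setOf_eq, Set.mem_union, Set.mem_singleton_iff]
  by_cases he : e = g
  · subst he
    rw [refinementOpen_iff_of_not_axial hg]
    simp
  · have hcongr : RefinementOpen 3 (insert (g.1, g.2, (0 : Fin 3)) S) e ↔ RefinementOpen 3 S e := by
      refine LandmarksA.refinementOpen_congr ?_ ?_ ?_
      · simp only [Set.mem_insert_iff, Prod.mk.injEq]
        constructor
        · rintro (⟨h1, h2, -⟩ | h); exacts [absurd (Prod.ext h1 h2) he, h]
        · exact fun h => Or.inr h
      · simp
      · simp
    rw [hcongr]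
    simp [he]

/-- Removing the own coin of a non-axial label closes exactly that label. -/
theorem op_diff_own {g : Site 2 × Fin 2} (hg : ¬ IsAxialEdge 3 g) (S : Set (Site 2 × Fin 2 × Fin 3)) :
    Op⟪S \ {(g.1, g.2, (0 : Fin 3))}⟫ = Op⟪S⟫ \ {g} := by
  ext e
  simp only [Set.mem_setOf_eq, Set.mem_sdiff, Set.mem_singleton_iff]
  by_cases he : e = g
  · subst he
    rw [refinementOpen_iff_of_not_axial hg]
    simp
  · have hcongr : RefinementOpen 3 (S \ {(g.1, g.2, (0 : Fin 3))}) e ↔ RefinementOpen 3 S e := by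
      refine LandmarksA.refinementOpen_congr ?_ ?_ ?_
      · simp only [Set.mem_sdiff, Set.mem_singleton_iff, Prod.mk.injEq]
        constructor
        · exact fun h => h.1
        · intro h; exact ⟨h, fun ⟨h1, h2, _⟩ => he (Prod.ext h1 h2)⟩
      · simp
      · simp
    rw [hcongr]
    simp [he]

/-- The section of the crossing event "own coin of `g` on" is `Z⟪{g}, {g}⟫` (for non-axial `g`). -/
theorem section_own_on {g : Site 2 × Fin 2} (hg : ¬ IsAxialEdge 3 g) :
    {S : Set (Site 2 × Fin 2 × Fin 3) | insert (g.1, g.2, (0 : Fin 3)) S ∈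
        (refinementConfig 3) ⁻¹' KST2023.crossing (3 * n) (3 * (3 * n))} =
      Z⟪({g} : Set (Site 2 × Fin 2)), ({g} : Set (Site 2 × Fin 2))⟫ := by
  ext S
  simp only [Set.mem_setOf_eq, Set.mem_preimage, refinementConfig_eq_edgeConfig, op_insert_own hg,
    Set.sdiff_union_self]

/-- The section of the crossing event "own coin of `g` off" is `Z⟪{g}, ∅⟫` (for non-axial `g`). -/
theorem section_own_off {g : Site 2 × Fin 2} (hg : ¬ IsAxialEdge 3 g) :
    {S : Set (Site 2 × Fin 2 × Fin 3) | S \ {(g.1, g.2, (0 : Fin 3))} ∈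
        (refinementConfig 3) ⁻¹' KST2023.crossing (3 * n) (3 * (3 * n))} =
      Z⟪({g} : Set (Site 2 × Fin 2)), (∅ : Set (Site 2 × Fin 2))⟫ := by
  ext S
  simp only [Set.mem_setOf_eq, Set.mem_preimage, refinementConfig_eq_edgeConfig, op_diff_own hg,
    Set.union_empty]

/-- The section of the crossing event "selector off" in terms of the own coins of the sub-edges. -/
theorem section_selector_off (hd : d' ≠ d) :
    {S : Set (Site 2 × Fin 2 × Fin 3) | S \ {(b, d, (2 : Fin 3))} ∈
        (refinementConfig 3) ⁻¹' KST2023.crossing (3 * n) (3 * (3 * n))} =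
      {S | edgeConfig ((Op⟪S⟫ \ Tl) ∪ Tof⟪S⟫) ∈ KST2023.crossing (3 * n) (3 * (3 * n))} := by
  ext S
  simp only [Set.mem_setOf_eq, Set.mem_preimage, refinementConfig_eq_edgeConfig, op_diff_selector hd]

/-- The section of the crossing event "selector on" in terms of the shared coin. -/
theorem section_selector_on (hd : d' ≠ d) :
    {S : Set (Site 2 × Fin 2 × Fin 3) | insert (b, d, (2 : Fin 3)) S ∈
        (refinementConfig 3) ⁻¹' KST2023.crossing (3 * n) (3 * (3 * n))} =
      {S | edgeConfig ((Op⟪S⟫ \ Tl) ∪ Th⟪S⟫) ∈ KST2023.crossing (3 * n) (3 * (3 * n))} := by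
  ext S
  simp only [Set.mem_setOf_eq, Set.mem_preimage, refinementConfig_eq_edgeConfig, op_insert_selector hd]

end Cone3

/-- **Registered sub-goal `stub_cone3_events` of stub `stub_cone3`**: inserting the own coin of an
interior label opens exactly that label (`Cone3.op_insert_own`) — the section identity behind
`Â^{g←1} = Z⟪{g}, {g}⟫` for the interior terms of Russo's formula. -/
theorem stub_cone3_events : ∀ (g : Site 2 × Fin 2), ¬ IsAxialEdge 3 g → ∀ S : Set (Site 2 × Fin 2 × Fin 3), {e : Site 2 × Fin 2 | RefinementOpen 3 (insert (g.1, g.2, (0 : Fin 3)) S) e} = {e : Site 2 × Fin 2 | RefinementOpen 3 S e} ∪ {g} :=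
  fun _ hg S => Cone3.op_insert_own hg S

end Summit.CriticalPhenomena.CardyFormulaZ2.Cruxes.CriticalPathRSW.FiniteSizeEnvelope

end
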